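import Summits.Ventures.LatticeQCDFlow.Scaling.StarLumpedBracket

/-!
HONEST FRAMING: exact (Metropolis-corrected) sampling algorithms for lattice gauge theory; figures
of merit are autocorrelation/cost numbers at stated couplings and volumes; no continuum-physics
claim.

# StarAdditiveCertificate — AN ENVIRONMENT-FREE ADDITIVE CERTIFICATE FOR THE HOMOGENEOUS `q`-CONTENT STAR: THE LUMPED CHECKLIST OF `StarLumpedBracket` REDUCES TO
# THREE SCALAR INEQUALITIES PER CONTENT TRIPLE (lean-2 GEN-34, ours)

Venture-side (OURS).  Cell `lqcd-flow` (pub-lqcd), unit `pub-lqcd-lean-2-g34`, 2026-08-29.  Chapter U (OPEN-MATH-chapterM item 1 (i), `q ≥ 3` contents, at slow-to-moderate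
swaps), file 1.  Setting of `StarLumpedBracket` (T5): persistent hub with exact redraws, `K` idle cold levels of ONE law `μ_1` on a finite content type `S`, identity maps, a
uniform entry list, hot law `μ_0`, synchronous coupling; `acc(u,v) = min{1, μ_0(v)μ_1(u)/(μ_0(u)μ_1(v))}`, type counts `cnt(x,y)(s,t) = #{i : (x_{i+1},y_{i+1}) = (s,t)}`.

THE CERTIFICATE.  A level-pair cost `G : S → S → ℝ` (`G(s,s) = 0`, `1 ≤ G(u,v) ≤ G_max` for `u ≠ v`), a hub-pair debt `E ≥ 0`, `σ = t/(t + (1−t)w_0)`, and the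
ONE-ATTEMPT NET GAIN of a disagreeing level of type `(u,v)` under an agreeing hub `z`,
`net(z;u,v) = min(acc(z,u),acc(z,v))·(G(u,v) − σE(u,v)) − (acc(z,u) − min)·(G(z,v) − G(u,v) + σE(u,z)) − (acc(z,v) − min)·(G(u,z) − G(u,v) + σE(z,v))`.
If (N) `net ≥ 0`, (D) for hub pairs `a ≠ b` and every level type `(s,t)` the one-attempt debt inequality
`min(α,β)(G(a,b) − G(s,t) + σE(s,t)) + (α − min)(G(a,t) − G(s,t) + σE(s,b)) + (β − min)(G(s,b) − G(s,t) + σE(a,t)) + (1 − α − β + min)·σE(a,b) ≤ E(a,b)` (`α = acc(a,s)`, `β = acc(b,t)`),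
and (R) `κ₀·G(u,v) ≤ Σ_z μ_0(z)·net(z;u,v)` (`0 < κ₀ ≤ 1`), then the type-lumped pair `Ψ = Σ_{(s,t)} cnt(s,t)·G(s,t)` (hub-INDEPENDENT, additive over the levels, no environment term),
`F = Ψ − (σ/K)·Σ_{(s,t)} cnt(s,t)·net(x_0;s,t)` at agreeing hubs, `F = Ψ + σE(x_0,y_0)` at disagreeing hubs, passes T5's checklist with `ρ = σκ₀/K`, `Ψ_max = K·G_max`:
**`t_mix(ε) ≤ ⌈(4/((1−t)w_0·ρ))·log((e·K·G_max + 1)/ε)⌉₊`** (`homStar_mixingTime_le_of_additiveCertificate`).  File 2 (`StarPersistenceWeights`) checks (N), (D), (R) for the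
persistence weight `G(u,v) = max{w(u),w(v)}`, `w = μ_1/μ_0`, `E = G/(1−2σ)`, `σ ≤ 1/5`; file 3 is the law.  Hypothesis-equations throughout; no definitions.

Proved: §1 `sum_indPair_mul`, `sum_shift_mul` (shifted counts), `net_le_cost` (`net ≤ G`), `addCert_NET_nonneg` ∕ `_le`; §2 `addCert_value_shift_le` (`F(x,y; cnt − 𝟙_{(u,v)} + 𝟙_{(p,q)}) ≤
Ψ − G(u,v) + G(p,q) + σE(x,y)`), `addCert_value_le`, **`addCert_bracket_agree_le`** (agreeing hub: the four-term bracket of type `(u,v)` is `≤ Ψ − net(z;u,v)`), **`addCert_bracket_disagree_le`**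
(`≤ Ψ + E(a,b)`); §3 **`homStar_mixingTime_le_of_additiveCertificate`**.  NOT CLAIMED here: (N), (D), (R) for any particular `G` (file 2); anything measured.  Literature grade (cell rule): OWN,
elementary; nothing cited as a fact; no new bib keys.
-/

noncomputable section
open Finset Function
open Literature.Probability.MarkovChains

namespace Summit.Ventures.LatticeQCDFlow.Scaling

/-! ## §1 Linear bookkeeping -/

section Lin
variable {S : Type*} [Fintype S] [DecidableEq S]

/-- `Σ_{(s,t)} 𝟙{(u,v) = (s,t)}·L(s,t) = L(u,v)`. [ours] -/
theorem sum_indPair_mul (L : S → S → ℝ) (u v : S) :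
    ∑ st : S × S, (if u = st.1 ∧ v = st.2 then (1 : ℝ) else 0) * L st.1 st.2 = L u v := by
  rw [Finset.sum_eq_single (u, v)]
  · simp
  · rintro st _ hst
    rw [if_neg (fun h => hst (Prod.ext h.1.symm h.2.symm)), zero_mul]
  · exact fun h => absurd (mem_univ _) h

/-- **Shifted counts against a linear functional:** `Σ (c − 𝟙_{(u,v)} + 𝟙_{(p,q)})·L = Σ c·L − L(u,v) + L(p,q)`. [ours] -/
theorem sum_shift_mul (c L : S → S → ℝ) (u v p q : S) :
    ∑ st : S × S, (c st.1 st.2 - (if u = st.1 ∧ v = st.2 then (1 : ℝ) else 0) + (if p = st.1 ∧ q = st.2 then (1 : ℝ) else 0)) * L st.1 st.2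
      = ∑ st : S × S, c st.1 st.2 * L st.1 st.2 - L u v + L p q := by
  simp_rw [add_mul, sub_mul]
  rw [Finset.sum_add_distrib, Finset.sum_sub_distrib, sum_indPair_mul, sum_indPair_mul]

omit [Fintype S] in
/-- A shifted count is entrywise non-negative when the removed type was present. [ours] -/
theorem shift_nonneg {c : S → S → ℝ} (hc : ∀ s t, 0 ≤ c s t) {u v : S} (huv : 1 ≤ c u v) (p q s t : S) :
    0 ≤ c s t - (if u = s ∧ v = t then (1 : ℝ) else 0) + (if p = s ∧ q = t then (1 : ℝ) else 0) := by
  have : 0 ≤ (if p = s ∧ q = t then (1 : ℝ) else 0) := by split_ifs <;> norm_num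
  by_cases h : u = s ∧ v = t
  · obtain ⟨rfl, rfl⟩ := h; rw [if_pos ⟨rfl, rfl⟩]; linarith
  · rw [if_neg h]; linarith [hc s t]

variable {acc G E : S → S → ℝ} {net : S → S → S → ℝ} {σ : ℝ}

omit [Fintype S] [DecidableEq S] in
/-- **`net ≤ G`:** the one-attempt net gain of a level never exceeds its cost (`0 ≤ acc ≤ 1`, `G, E ≥ 0`, `σ ≥ 0`). [ours] -/
theorem net_le_cost (hacc0 : ∀ u v, 0 ≤ acc u v) (hacc1 : ∀ u v, acc u v ≤ 1) (hG0 : ∀ u v, 0 ≤ G u v) (hE0 : ∀ u v, 0 ≤ E u v) (hσ0 : 0 ≤ σ)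
    (hnet : ∀ z u v, net z u v = min (acc z u) (acc z v) * (G u v - σ * E u v)
      - (acc z u - min (acc z u) (acc z v)) * (G z v - G u v + σ * E u z) - (acc z v - min (acc z u) (acc z v)) * (G u z - G u v + σ * E z v))
    (z u v : S) : net z u v ≤ G u v := by
  rw [hnet]
  have h1 : min (acc z u) (acc z v) ≤ acc z u := min_le_left _ _
  have h2 : min (acc z u) (acc z v) ≤ acc z v := min_le_right _ _
  have h3 : 0 ≤ min (acc z u) (acc z v) := le_min (hacc0 z u) (hacc0 z v)
  have h4 : acc z u + acc z v - min (acc z u) (acc z v) ≤ 1 := by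
    rcases le_total (acc z u) (acc z v) with h | h <;> [rw [min_eq_left h]; rw [min_eq_right h]] <;> linarith [hacc1 z v, hacc1 z u]
  nlinarith [hG0 u v, hG0 z v, hG0 u z, hE0 u v, hE0 u z, hE0 z v, mul_nonneg hσ0 (hE0 u v), mul_nonneg hσ0 (hE0 u z), mul_nonneg hσ0 (hE0 z v),
    mul_nonneg h3 (mul_nonneg hσ0 (hE0 u v)), mul_nonneg (sub_nonneg.mpr h1) (add_nonneg (hG0 z v) (mul_nonneg hσ0 (hE0 u z))),
    mul_nonneg (sub_nonneg.mpr h2) (add_nonneg (hG0 u z) (mul_nonneg hσ0 (hE0 z v))), mul_nonneg (sub_nonneg.mpr (show acc z u + acc z v - min (acc z u) (acc z v) ≤ 1 from h4)) (hG0 u v)]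

variable {NET : S → (S → S → ℝ) → ℝ}

omit [DecidableEq S] in
/-- `NET(z;c) = Σ c·net(z;·,·) ≥ 0` for non-negative counts (N). [ours] -/
theorem addCert_NET_nonneg (hN : ∀ z u v, 0 ≤ net z u v) (hNET : ∀ z c, NET z c = ∑ st : S × S, c st.1 st.2 * net z st.1 st.2)
    (z : S) {c : S → S → ℝ} (hc : ∀ s t, 0 ≤ c s t) : 0 ≤ NET z c := by
  rw [hNET]; exact sum_nonneg fun st _ => mul_nonneg (hc _ _) (hN _ _ _)

omit [DecidableEq S] in
/-- `NET(z;c) ≤ Ψ(c)` (`net ≤ G`). [ours] -/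
theorem addCert_NET_le (hNG : ∀ z u v, net z u v ≤ G u v) (hNET : ∀ z c, NET z c = ∑ st : S × S, c st.1 st.2 * net z st.1 st.2)
    {Ψl : (S → S → ℝ) → ℝ} (hΨl : ∀ c, Ψl c = ∑ st : S × S, c st.1 st.2 * G st.1 st.2)
    (z : S) {c : S → S → ℝ} (hc : ∀ s t, 0 ≤ c s t) : NET z c ≤ Ψl c := by
  rw [hNET, hΨl]; exact sum_le_sum fun st _ => mul_le_mul_of_nonneg_left (hNG _ _ _) (hc _ _)

end Lin

/-! ## §2 The value of `F` after a swap outcome; the two bracket bounds -/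

section Bracket
variable {S : Type*} [Fintype S] [DecidableEq S] {K : ℕ}
variable {acc G E : S → S → ℝ} {net : S → S → S → ℝ} {σ : ℝ} {NET : S → (S → S → ℝ) → ℝ} {Ψl : (S → S → ℝ) → ℝ} {Fl : S → S → (S → S → ℝ) → ℝ}

/-- **The value after a swap outcome.**  For the certificate pair (`F = Ψ − (σ/K)·NET(x_0;·)` at agreeing hubs, `Ψ + σE(x_0,y_0)` at disagreeing hubs), at counts shifted by
`−𝟙_{(u,v)} + 𝟙_{(p,q)}` (the type `(u,v)` present): `F(x,y;cnt') ≤ Ψ(cnt) − G(u,v) + G(p,q) + σE(x,y)` — equality at a disagreeing hub pair, `NET ≥ 0` dropped at an agreeing one. [ours] -/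
theorem addCert_value_shift_le (hE0 : ∀ u v, 0 ≤ E u v) (hσ0 : 0 ≤ σ)
    (hN : ∀ z u v, 0 ≤ net z u v) (hNET : ∀ z c, NET z c = ∑ st : S × S, c st.1 st.2 * net z st.1 st.2)
    (hΨl : ∀ c, Ψl c = ∑ st : S × S, c st.1 st.2 * G st.1 st.2)
    (hFl : ∀ x y c, Fl x y c = Ψl c + (if x = y then -(σ / K) * NET x c else σ * E x y))
    {c : S → S → ℝ} (hc : ∀ s t, 0 ≤ c s t) {u v : S} (huv : 1 ≤ c u v) (x y p q : S) :
    Fl x y (fun s t => c s t - (if u = s ∧ v = t then (1 : ℝ) else 0) + (if p = s ∧ q = t then (1 : ℝ) else 0))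
      ≤ Ψl c - G u v + G p q + σ * E x y := by
  have hΨ' : Ψl (fun s t => c s t - (if u = s ∧ v = t then (1 : ℝ) else 0) + (if p = s ∧ q = t then (1 : ℝ) else 0))
      = Ψl c - G u v + G p q := by
    rw [hΨl, hΨl]; exact sum_shift_mul c G u v p q
  rw [hFl, hΨ']
  by_cases hxy : x = y
  · rw [if_pos hxy]
    have hN0 := addCert_NET_nonneg hN hNET x (shift_nonneg hc huv p q)
    have hK : 0 ≤ σ / K := div_nonneg hσ0 (Nat.cast_nonneg K)
    nlinarith [hE0 x y, mul_nonneg hK hN0]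
  · rw [if_neg hxy]

/-- At an agreeing hub the value is at most `Ψ`. [ours] -/
theorem addCert_value_le (hσ0 : 0 ≤ σ)
    (hN : ∀ z u v, 0 ≤ net z u v) (hNET : ∀ z c, NET z c = ∑ st : S × S, c st.1 st.2 * net z st.1 st.2)
    (hFl : ∀ x y c, Fl x y c = Ψl c + (if x = y then -(σ / K) * NET x c else σ * E x y))
    {c : S → S → ℝ} (hc : ∀ s t, 0 ≤ c s t) (z : S) : Fl z z c ≤ Ψl c := by
  rw [hFl, if_pos rfl]
  have hN0 := addCert_NET_nonneg hN hNET z hc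
  have hK : 0 ≤ σ / K := div_nonneg hσ0 (Nat.cast_nonneg K)
  nlinarith [mul_nonneg hK hN0]

/-- **THE BRACKET AT AN AGREEING HUB.**  For hub `(z,z)` and a present level type `(u,v)`, the four-term synchronous bracket of T5 (both accept: hubs `(u,v)`, level `(z,z)`; first
copy only: hubs `(u,z)`, level `(z,v)`; second only: hubs `(z,v)`, level `(u,z)`; neither) applied to `F` is at most `Ψ(cnt) − net(z;u,v)`. [ours] -/
theorem addCert_bracket_agree_le (hacc0 : ∀ u v, 0 ≤ acc u v) (hacc1 : ∀ u v, acc u v ≤ 1)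
    (hG0d : ∀ s, G s s = 0) (hE0 : ∀ u v, 0 ≤ E u v) (hσ0 : 0 ≤ σ)
    (hnet : ∀ z u v, net z u v = min (acc z u) (acc z v) * (G u v - σ * E u v)
      - (acc z u - min (acc z u) (acc z v)) * (G z v - G u v + σ * E u z) - (acc z v - min (acc z u) (acc z v)) * (G u z - G u v + σ * E z v))
    (hN : ∀ z u v, 0 ≤ net z u v) (hNET : ∀ z c, NET z c = ∑ st : S × S, c st.1 st.2 * net z st.1 st.2)
    (hΨl : ∀ c, Ψl c = ∑ st : S × S, c st.1 st.2 * G st.1 st.2)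
    (hFl : ∀ x y c, Fl x y c = Ψl c + (if x = y then -(σ / K) * NET x c else σ * E x y))
    {c : S → S → ℝ} (hc : ∀ s t, 0 ≤ c s t) (z : S) {u v : S} (huv : 1 ≤ c u v) :
    min (acc z u) (acc z v) * Fl u v (fun s t => c s t - (if u = s ∧ v = t then (1 : ℝ) else 0) + (if z = s ∧ z = t then (1 : ℝ) else 0))
      + (acc z u - min (acc z u) (acc z v))
          * Fl u z (fun s t => c s t - (if u = s ∧ v = t then (1 : ℝ) else 0) + (if z = s ∧ v = t then (1 : ℝ) else 0))
      + (acc z v - min (acc z u) (acc z v))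
          * Fl z v (fun s t => c s t - (if u = s ∧ v = t then (1 : ℝ) else 0) + (if u = s ∧ z = t then (1 : ℝ) else 0))
      + (1 - acc z u - acc z v + min (acc z u) (acc z v)) * Fl z z c
      ≤ Ψl c - net z u v := by
  have h1 := addCert_value_shift_le (K := K) (G := G) hE0 hσ0 hN hNET hΨl hFl hc huv u v z z
  have h2 := addCert_value_shift_le (K := K) (G := G) hE0 hσ0 hN hNET hΨl hFl hc huv u z z v
  have h3 := addCert_value_shift_le (K := K) (G := G) hE0 hσ0 hN hNET hΨl hFl hc huv z v u z
  have h4 := addCert_value_le (K := K) (E := E) hσ0 hN hNET hFl hc z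
  rw [hG0d z] at h1
  have c1 : 0 ≤ min (acc z u) (acc z v) := le_min (hacc0 z u) (hacc0 z v)
  have c2 : 0 ≤ acc z u - min (acc z u) (acc z v) := sub_nonneg.mpr (min_le_left _ _)
  have c3 : 0 ≤ acc z v - min (acc z u) (acc z v) := sub_nonneg.mpr (min_le_right _ _)
  have c4 : 0 ≤ 1 - acc z u - acc z v + min (acc z u) (acc z v) := by
    rcases le_total (acc z u) (acc z v) with h | h <;> [rw [min_eq_left h]; rw [min_eq_right h]] <;> linarith [hacc1 z v, hacc1 z u]
  rw [hnet]
  nlinarith [mul_le_mul_of_nonneg_left h1 c1, mul_le_mul_of_nonneg_left h2 c2, mul_le_mul_of_nonneg_left h3 c3, mul_le_mul_of_nonneg_left h4 c4]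

/-- **THE BRACKET AT A DISAGREEING HUB.**  For hubs `(a,b)`, `a ≠ b`, and a present level type `(s,t)`, the four-term bracket applied to `F` is at most `Ψ(cnt) + E(a,b)` — by the
one-attempt debt inequality (D). [ours] -/
theorem addCert_bracket_disagree_le (hacc0 : ∀ u v, 0 ≤ acc u v) (hacc1 : ∀ u v, acc u v ≤ 1)
    (hE0 : ∀ u v, 0 ≤ E u v) (hσ0 : 0 ≤ σ)
    (hN : ∀ z u v, 0 ≤ net z u v) (hNET : ∀ z c, NET z c = ∑ st : S × S, c st.1 st.2 * net z st.1 st.2)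
    (hΨl : ∀ c, Ψl c = ∑ st : S × S, c st.1 st.2 * G st.1 st.2)
    (hFl : ∀ x y c, Fl x y c = Ψl c + (if x = y then -(σ / K) * NET x c else σ * E x y))
    (hD : ∀ a b s t, a ≠ b →
      min (acc a s) (acc b t) * (G a b - G s t + σ * E s t) + (acc a s - min (acc a s) (acc b t)) * (G a t - G s t + σ * E s b)
        + (acc b t - min (acc a s) (acc b t)) * (G s b - G s t + σ * E a t) + (1 - acc a s - acc b t + min (acc a s) (acc b t)) * (σ * E a b) ≤ E a b)
    {c : S → S → ℝ} (hc : ∀ s t, 0 ≤ c s t) {a b : S} (hab : a ≠ b) {s t : S} (hst : 1 ≤ c s t) :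
    min (acc a s) (acc b t) * Fl s t (fun s' t' => c s' t' - (if s = s' ∧ t = t' then (1 : ℝ) else 0) + (if a = s' ∧ b = t' then (1 : ℝ) else 0))
      + (acc a s - min (acc a s) (acc b t))
          * Fl s b (fun s' t' => c s' t' - (if s = s' ∧ t = t' then (1 : ℝ) else 0) + (if a = s' ∧ t = t' then (1 : ℝ) else 0))
      + (acc b t - min (acc a s) (acc b t))
          * Fl a t (fun s' t' => c s' t' - (if s = s' ∧ t = t' then (1 : ℝ) else 0) + (if s = s' ∧ b = t' then (1 : ℝ) else 0))
      + (1 - acc a s - acc b t + min (acc a s) (acc b t)) * Fl a b c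
      ≤ Ψl c + E a b := by
  have h1 := addCert_value_shift_le (K := K) (G := G) hE0 hσ0 hN hNET hΨl hFl hc hst s t a b
  have h2 := addCert_value_shift_le (K := K) (G := G) hE0 hσ0 hN hNET hΨl hFl hc hst s b a t
  have h3 := addCert_value_shift_le (K := K) (G := G) hE0 hσ0 hN hNET hΨl hFl hc hst a t s b
  have h4 : Fl a b c = Ψl c + σ * E a b := by rw [hFl, if_neg hab]
  have c1 : 0 ≤ min (acc a s) (acc b t) := le_min (hacc0 a s) (hacc0 b t)
  have c2 : 0 ≤ acc a s - min (acc a s) (acc b t) := sub_nonneg.mpr (min_le_left _ _)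
  have c3 : 0 ≤ acc b t - min (acc a s) (acc b t) := sub_nonneg.mpr (min_le_right _ _)
  have c4 : 0 ≤ 1 - acc a s - acc b t + min (acc a s) (acc b t) := by
    rcases le_total (acc a s) (acc b t) with h | h <;> [rw [min_eq_left h]; rw [min_eq_right h]] <;> linarith [hacc1 b t, hacc1 a s]
  have hD' := hD a b s t hab
  rw [h4]
  nlinarith [mul_le_mul_of_nonneg_left h1 c1, mul_le_mul_of_nonneg_left h2 c2, mul_le_mul_of_nonneg_left h3 c3]

end Bracket

/-! ## §3 The checklist and the law -/

section Law
variable {K m : ℕ} {S : Type*} [Fintype S] [DecidableEq S] {μ : Fin (K + 1) → S → ℝ}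
variable (κ : Fin m → Fin K)
variable {M : Fin (K + 1) → S → S → ℝ} {w : Fin (K + 1) → ℝ} {t : ℝ}
variable {cnt : (Fin (K + 1) → S) × (Fin (K + 1) → S) → S → S → ℝ}

/-- The type counts of a configuration pair sum to `K`. [ours] -/
theorem homStar_cnt_sum (hcnt : ∀ a s t, cnt a s t = ((univ.filter fun i : Fin K => a.1 i.succ = s ∧ a.2 i.succ = t).card : ℝ))
    (a : (Fin (K + 1) → S) × (Fin (K + 1) → S)) : ∑ st : S × S, cnt a st.1 st.2 = K := by
  classical
  have h := sum_eq_sum_pairTypeS (fun i : Fin K => a.1 i.succ) (fun i : Fin K => a.2 i.succ) (fun _ _ => (1 : ℝ))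
  simp only [mul_one, sum_const, card_univ, Fintype.card_fin, nsmul_eq_mul] at h
  rw [h]
  exact sum_congr rfl fun st _ => by rw [hcnt]

omit [Fintype S] in
/-- A type count is `0` or at least `1`. [ours] -/
theorem homStar_cnt_dichotomy (hcnt : ∀ a s t, cnt a s t = ((univ.filter fun i : Fin K => a.1 i.succ = s ∧ a.2 i.succ = t).card : ℝ))
    (a : (Fin (K + 1) → S) × (Fin (K + 1) → S)) (s t : S) : cnt a s t = 0 ∨ 1 ≤ cnt a s t := by
  classical
  rw [hcnt]
  rcases Nat.eq_zero_or_pos ((univ.filter fun i : Fin K => a.1 i.succ = s ∧ a.2 i.succ = t).card) with h | h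
  · left; exact_mod_cast h
  · right; exact_mod_cast h

/-- **THE ENVIRONMENT-FREE ADDITIVE CERTIFICATE ⇒ MIXING TIME.**  Homogeneous `q`-content star (persistent hub with exact redraws of weight `w_0 > 0`, `K` idle cold levels of one law
`μ_1`, identity maps, uniform entry list with `c` entries per level, `0 < t < 1`).  Level-pair cost `G` (`G(s,s) = 0`, `1 ≤ G(u,v)` for `u ≠ v`, `0 ≤ G ≤ G_max`), hub-pair debt
`E ≥ 0`, `σ = t/(t + (1−t)w_0)`, `net` as displayed in the module docstring; if (N) `net ≥ 0`, (D) the one-attempt debt inequality at every disagreeing hub pair and every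
level type, and (R) `κ₀·G(u,v) ≤ Σ_z μ_0(z)·net(z;u,v)` with `0 < κ₀ ≤ 1`, then
**`t_mix(ε) ≤ ⌈(4/((1−t)w_0·(σκ₀/K)))·log((e·(K·G_max) + 1)/ε)⌉₊`**. [ours] -/
theorem homStar_mixingTime_le_of_additiveCertificate [Nonempty S] (hm : 1 ≤ m) (ht0 : 0 < t) (ht1 : t < 1) (hw0 : ∀ k, 0 ≤ w k) (hw00 : 0 < w 0)
    (hw1 : ∑ k, w k = 1) (hμ : ∀ k x, 0 < μ k x) (hμ1 : ∀ k, ∑ u, μ k u = 1) (hM0 : ∀ u v, M 0 u v = μ 0 v)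
    (hidle : ∀ i : Fin K, ∀ u v, M i.succ u v = if v = u then 1 else 0) (hhom : ∀ i : Fin K, μ i.succ = μ 1)
    {c : ℕ} (hunif : ∀ i : Fin K, (univ.filter fun r : Fin m => κ r = i).card = c)
    {acc : S → S → ℝ} (hacc : ∀ u v, acc u v = min 1 (μ 0 v * μ 1 u / (μ 0 u * μ 1 v)))
    (hcnt : ∀ a s t, cnt a s t = ((univ.filter fun i : Fin K => a.1 i.succ = s ∧ a.2 i.succ = t).card : ℝ))
    {G E : S → S → ℝ} {Gmax κ₀ σ : ℝ} (hG0d : ∀ s, G s s = 0) (hG1 : ∀ u v, u ≠ v → 1 ≤ G u v) (hG0 : ∀ u v, 0 ≤ G u v) (hGmax : ∀ u v, G u v ≤ Gmax)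
    (hE0 : ∀ u v, 0 ≤ E u v) (hσ : σ = t / (t + (1 - t) * w 0))
    {net : S → S → S → ℝ}
    (hnet : ∀ z u v, net z u v = min (acc z u) (acc z v) * (G u v - σ * E u v)
      - (acc z u - min (acc z u) (acc z v)) * (G z v - G u v + σ * E u z) - (acc z v - min (acc z u) (acc z v)) * (G u z - G u v + σ * E z v))
    (hN : ∀ z u v, 0 ≤ net z u v)
    (hD : ∀ a b s t, a ≠ b →
      min (acc a s) (acc b t) * (G a b - G s t + σ * E s t) + (acc a s - min (acc a s) (acc b t)) * (G a t - G s t + σ * E s b)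
        + (acc b t - min (acc a s) (acc b t)) * (G s b - G s t + σ * E a t) + (1 - acc a s - acc b t + min (acc a s) (acc b t)) * (σ * E a b) ≤ E a b)
    (hR : ∀ u v, κ₀ * G u v ≤ ∑ z, μ 0 z * net z u v) (hκ0 : 0 < κ₀) (hκ1 : κ₀ ≤ 1)
    {ε : ℝ} (hε : 0 < ε) :
    mixingTime (fun y z : Fin (K + 1) → S =>
        t * ptGraphSwap μ (fun r : Fin m => (((0 : Fin (K + 1)), (κ r).succ) : Fin (K + 1) × Fin (K + 1))) (fun _ : Fin m => Equiv.refl S) y z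
          + (1 - t) * prodKernel w M y z) (tensorFun μ) ε
      ≤ ⌈1 / ((1 - t) * w 0 * (σ * κ₀ / K) / 4) * Real.log ((Real.exp 1 * (K * Gmax) + 1) / ε)⌉₊ := by
  classical
  -- constants
  have hh0 : 0 < (1 - t) * w 0 := mul_pos (by linarith) hw00
  have hth : 0 < t + (1 - t) * w 0 := by linarith
  have hσ0 : 0 < σ := by rw [hσ]; exact div_pos ht0 hth
  have hσ1 : σ ≤ 1 := by rw [hσ, div_le_one hth]; linarith
  have hσt : σ * (t + (1 - t) * w 0) = t := by rw [hσ]; field_simp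
  have hK1 : 1 ≤ K := by
    rcases Nat.eq_zero_or_pos K with hK0 | hK0
    · exfalso; subst hK0
      have hmK := uniformList_card κ hunif
      simp only [CharP.cast_eq_zero, mul_zero, Nat.cast_eq_zero] at hmK; omega
    · exact hK0
  have hKpos : (0 : ℝ) < K := by exact_mod_cast hK1
  have hacc0 : ∀ u v, 0 ≤ acc u v := fun u v => by
    rw [hacc]; exact le_min zero_le_one (div_nonneg (mul_nonneg (hμ _ _).le (hμ _ _).le) (mul_nonneg (hμ _ _).le (hμ _ _).le))
  have hacc1 : ∀ u v, acc u v ≤ 1 := fun u v => by rw [hacc]; exact min_le_left _ _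
  have hNG : ∀ z u v, net z u v ≤ G u v := net_le_cost hacc0 hacc1 hG0 hE0 hσ0.le hnet
  -- the certificate pair, as hypothesis-equations
  let NET : S → (S → S → ℝ) → ℝ := fun z c => ∑ st : S × S, c st.1 st.2 * net z st.1 st.2
  have hNET : ∀ z c, NET z c = ∑ st : S × S, c st.1 st.2 * net z st.1 st.2 := fun z c => rfl
  let Ψl : (S → S → ℝ) → ℝ := fun c => ∑ st : S × S, c st.1 st.2 * G st.1 st.2
  have hΨl : ∀ c, Ψl c = ∑ st : S × S, c st.1 st.2 * G st.1 st.2 := fun c => rfl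
  let Fl : S → S → (S → S → ℝ) → ℝ := fun x y c => Ψl c + (if x = y then -(σ / K) * NET x c else σ * E x y)
  have hFl : ∀ x y c, Fl x y c = Ψl c + (if x = y then -(σ / K) * NET x c else σ * E x y) := fun x y c => rfl
  have hcnt0 : ∀ a s t, 0 ≤ cnt a s t := fun a s t => by rw [hcnt]; exact Nat.cast_nonneg _
  have hΨnn : ∀ a : (Fin (K + 1) → S) × (Fin (K + 1) → S), 0 ≤ Ψl (cnt a) := fun a =>
    sum_nonneg fun st _ => mul_nonneg (hcnt0 a _ _) (hG0 _ _)
  refine homStar_mixingTime_le_of_lumped_supersolution κ hm ht0.le ht1 hw0 hw00 hw1 hμ hμ1 hM0 hidle hhom hunif hacc hcnt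
    (Fl := Fl) (Ψl := fun _ _ c => Ψl c) (Ψmax := K * Gmax) (ρ := σ * κ₀ / K)
    (fun a => ?_) (fun a => hΨnn a) (fun a => ?_) (fun a hex => ?_) (by positivity) ?_ (fun a => ?_) (fun a => ?_) hε
  · -- `F ≥ 0`
    show 0 ≤ Fl (a.1 0) (a.2 0) (cnt a)
    rw [hFl]
    split_ifs with h
    · have h1 : NET (a.1 0) (cnt a) ≤ Ψl (cnt a) := addCert_NET_le hNG hNET hΨl (a.1 0) (hcnt0 a)
      have h2 : σ / K ≤ 1 := by rw [div_le_one hKpos]; exact hσ1.trans (by exact_mod_cast hK1)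
      have h3 : 0 ≤ σ / K := div_nonneg hσ0.le hKpos.le
      nlinarith [hΨnn a, addCert_NET_nonneg hN hNET (a.1 0) (hcnt0 a)]
    · nlinarith [hΨnn a, hE0 (a.1 0) (a.2 0), hσ0]
  · -- `Ψ ≤ K·G_max`
    show Ψl (cnt a) ≤ K * Gmax
    calc Ψl (cnt a) = ∑ st : S × S, cnt a st.1 st.2 * G st.1 st.2 := rfl
      _ ≤ ∑ st : S × S, cnt a st.1 st.2 * Gmax := sum_le_sum fun st _ => mul_le_mul_of_nonneg_left (hGmax _ _) (hcnt0 a _ _)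
      _ = K * Gmax := by rw [← Finset.sum_mul]; rw [homStar_cnt_sum hcnt a]
  · -- `Ψ ≥ 1` where a cold level differs
    obtain ⟨i, hi⟩ := hex
    show 1 ≤ Ψl (cnt a)
    have hmem : (1 : ℝ) ≤ cnt a (a.1 i.succ) (a.2 i.succ) := by
      rw [hcnt]
      have : 1 ≤ (univ.filter fun j : Fin K => a.1 j.succ = a.1 i.succ ∧ a.2 j.succ = a.2 i.succ).card :=
        Finset.card_pos.mpr ⟨i, by simp⟩
      exact_mod_cast this
    calc (1 : ℝ) ≤ cnt a (a.1 i.succ) (a.2 i.succ) * G (a.1 i.succ) (a.2 i.succ) := by nlinarith [hG1 _ _ hi]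
      _ ≤ Ψl (cnt a) := by
        rw [hΨl]
        exact Finset.single_le_sum (f := fun st : S × S => cnt a st.1 st.2 * G st.1 st.2)
          (fun st _ => mul_nonneg (hcnt0 a _ _) (hG0 _ _)) (mem_univ (a.1 i.succ, a.2 i.succ))
  · -- `ρ ≤ 1`
    rw [div_le_one hKpos]
    calc σ * κ₀ ≤ 1 * 1 := mul_le_mul hσ1 hκ1 hκ0.le zero_le_one
      _ ≤ K := by rw [one_mul]; exact_mod_cast hK1
  · -- the lumped bracket inequality
    have hsumK := homStar_cnt_sum hcnt a
    by_cases hab : a.1 0 = a.2 0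
    · -- agreeing hub `z`
      have hz : a.2 0 = a.1 0 := hab.symm
      have hterm : ∀ st : S × S, cnt a st.1 st.2 *
          (min (acc (a.1 0) st.1) (acc (a.2 0) st.2)
              * Fl st.1 st.2 (fun s t' => cnt a s t' - (if st.1 = s ∧ st.2 = t' then 1 else 0) + (if a.1 0 = s ∧ a.2 0 = t' then 1 else 0))
            + (acc (a.1 0) st.1 - min (acc (a.1 0) st.1) (acc (a.2 0) st.2))
              * Fl st.1 (a.2 0) (fun s t' => cnt a s t' - (if st.1 = s ∧ st.2 = t' then 1 else 0) + (if a.1 0 = s ∧ st.2 = t' then 1 else 0))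
            + (acc (a.2 0) st.2 - min (acc (a.1 0) st.1) (acc (a.2 0) st.2))
              * Fl (a.1 0) st.2 (fun s t' => cnt a s t' - (if st.1 = s ∧ st.2 = t' then 1 else 0) + (if st.1 = s ∧ a.2 0 = t' then 1 else 0))
            + (1 - acc (a.1 0) st.1 - acc (a.2 0) st.2 + min (acc (a.1 0) st.1) (acc (a.2 0) st.2)) * Fl (a.1 0) (a.2 0) (cnt a))
          ≤ cnt a st.1 st.2 * (Ψl (cnt a) - net (a.1 0) st.1 st.2) := by
        intro st
        rcases homStar_cnt_dichotomy hcnt a st.1 st.2 with h0 | h1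
        · rw [h0, zero_mul, zero_mul]
        · refine mul_le_mul_of_nonneg_left ?_ (hcnt0 a _ _)
          rw [hz]
          exact addCert_bracket_agree_le (K := K) hacc0 hacc1 hG0d hE0 hσ0.le hnet hN hNET hΨl hFl (hcnt0 a) (a.1 0) h1
      have hsum := sum_le_sum fun st (_ : st ∈ (univ : Finset (S × S))) => hterm st
      have hsplit : ∑ st : S × S, cnt a st.1 st.2 * (Ψl (cnt a) - net (a.1 0) st.1 st.2) = K * Ψl (cnt a) - NET (a.1 0) (cnt a) := by
        simp_rw [mul_sub]
        rw [Finset.sum_sub_distrib, ← Finset.sum_mul, hsumK]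
      rw [hsplit] at hsum
      have hF : Fl (a.1 0) (a.2 0) (cnt a) = Ψl (cnt a) - σ / K * NET (a.1 0) (cnt a) := by rw [hFl, if_pos hab]; ring
      have htK : 0 ≤ t / K := div_nonneg ht0.le hKpos.le
      have key : t / K * (K * Ψl (cnt a) - NET (a.1 0) (cnt a)) = t * Ψl (cnt a) - t / K * NET (a.1 0) (cnt a) := by
        field_simp
      have hrhs : (t + (1 - t) * w 0) * Fl (a.1 0) (a.2 0) (cnt a) = (t + (1 - t) * w 0) * Ψl (cnt a) - t / K * NET (a.1 0) (cnt a) := by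
        rw [hF, mul_sub, show (t + (1 - t) * w 0) * (σ / K * NET (a.1 0) (cnt a)) = σ * (t + (1 - t) * w 0) / K * NET (a.1 0) (cnt a) by ring, hσt]
      rw [hrhs]
      nlinarith [mul_le_mul_of_nonneg_left hsum htK, key]
    · -- disagreeing hub `(a,b)`
      have hterm : ∀ st : S × S, cnt a st.1 st.2 *
          (min (acc (a.1 0) st.1) (acc (a.2 0) st.2)
              * Fl st.1 st.2 (fun s t' => cnt a s t' - (if st.1 = s ∧ st.2 = t' then 1 else 0) + (if a.1 0 = s ∧ a.2 0 = t' then 1 else 0))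
            + (acc (a.1 0) st.1 - min (acc (a.1 0) st.1) (acc (a.2 0) st.2))
              * Fl st.1 (a.2 0) (fun s t' => cnt a s t' - (if st.1 = s ∧ st.2 = t' then 1 else 0) + (if a.1 0 = s ∧ st.2 = t' then 1 else 0))
            + (acc (a.2 0) st.2 - min (acc (a.1 0) st.1) (acc (a.2 0) st.2))
              * Fl (a.1 0) st.2 (fun s t' => cnt a s t' - (if st.1 = s ∧ st.2 = t' then 1 else 0) + (if st.1 = s ∧ a.2 0 = t' then 1 else 0))
            + (1 - acc (a.1 0) st.1 - acc (a.2 0) st.2 + min (acc (a.1 0) st.1) (acc (a.2 0) st.2)) * Fl (a.1 0) (a.2 0) (cnt a))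
          ≤ cnt a st.1 st.2 * (Ψl (cnt a) + E (a.1 0) (a.2 0)) := by
        intro st
        rcases homStar_cnt_dichotomy hcnt a st.1 st.2 with h0 | h1
        · rw [h0, zero_mul, zero_mul]
        · refine mul_le_mul_of_nonneg_left ?_ (hcnt0 a _ _)
          exact addCert_bracket_disagree_le (K := K) hacc0 hacc1 hE0 hσ0.le hN hNET hΨl hFl hD (hcnt0 a) hab h1
      have hsum := sum_le_sum fun st (_ : st ∈ (univ : Finset (S × S))) => hterm st
      rw [← Finset.sum_mul, hsumK] at hsum
      have hF : Fl (a.1 0) (a.2 0) (cnt a) = Ψl (cnt a) + σ * E (a.1 0) (a.2 0) := by rw [hFl, if_neg hab]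
      have htK : 0 ≤ t / K := div_nonneg ht0.le hKpos.le
      have key : t / K * (K * (Ψl (cnt a) + E (a.1 0) (a.2 0))) = t * Ψl (cnt a) + t * E (a.1 0) (a.2 0) := by field_simp
      have hrhs : (t + (1 - t) * w 0) * Fl (a.1 0) (a.2 0) (cnt a) = (t + (1 - t) * w 0) * Ψl (cnt a) + t * E (a.1 0) (a.2 0) := by
        rw [hF, mul_add, show (t + (1 - t) * w 0) * (σ * E (a.1 0) (a.2 0)) = σ * (t + (1 - t) * w 0) * E (a.1 0) (a.2 0) by ring, hσt]
      rw [hrhs]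
      nlinarith [mul_le_mul_of_nonneg_left hsum htK, key]
  · -- the lumped redraw inequality
    show ∑ v, μ 0 v * Fl v v (cnt a) ≤ (1 - σ * κ₀ / K) * Ψl (cnt a)
    have hFv : ∀ v, Fl v v (cnt a) = Ψl (cnt a) - σ / K * NET v (cnt a) := fun v => by rw [hFl, if_pos rfl]; ring
    simp_rw [hFv, mul_sub]
    rw [Finset.sum_sub_distrib, ← Finset.sum_mul, hμ1 0, one_mul]
    -- `Σ_v μ_0(v)·NET(v;c) = Σ_{(s,t)} c(s,t)·Σ_v μ_0(v)·net(v;s,t) ≥ κ₀·Ψ`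
    have hex : ∑ v, μ 0 v * (σ / K * NET v (cnt a)) = σ / K * ∑ st : S × S, cnt a st.1 st.2 * ∑ v, μ 0 v * net v st.1 st.2 := by
      simp_rw [hNET, Finset.mul_sum]
      rw [Finset.sum_comm]
      refine sum_congr rfl fun st _ => ?_
      exact sum_congr rfl fun v _ => by ring
    rw [hex]
    have hlow : κ₀ * Ψl (cnt a) ≤ ∑ st : S × S, cnt a st.1 st.2 * ∑ v, μ 0 v * net v st.1 st.2 := by
      rw [hΨl, Finset.mul_sum]
      refine sum_le_sum fun st _ => ?_
      have := mul_le_mul_of_nonneg_left (hR st.1 st.2) (hcnt0 a st.1 st.2)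
      linarith [this]
    have h3 : 0 ≤ σ / K := div_nonneg hσ0.le hKpos.le
    have : σ * κ₀ / K * Ψl (cnt a) = σ / K * (κ₀ * Ψl (cnt a)) := by ring
    nlinarith [mul_le_mul_of_nonneg_left hlow h3, this]

end Law

end Summit.Ventures.LatticeQCDFlow.Scaling

end
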